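import Literature.NumberTheory.GaloisRepresentations.InfResTwo
import HarnessLib

/-!
# Restriction calculus for continuous cochains: composition and transport along isomorphisms

Bookkeeping lemmas for Mathlib's `ContinuousCohomology.cochainsMap` used when the ambient
profinite group changes (a subgroup of a subgroup, an isomorphic copy of a subgroup):

* `resolutionMap_comp_apply_of`, `cochainsMap_comp_apply_of` — `cochainsMap` along a composite
  `χ = φ ∘ ψ` is the composite of the `cochainsMap`s, on elements, for maps given pointwise;
* `exists_d_eq_cochainsMap_of` — hence "the restriction along `χ` is a coboundary" follows from
  "the restriction along `φ` is a coboundary";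
* `subsingleton_iff_of_continuousMulEquiv` — `Hq` of isomorphic pairs (topological group
  isomorphism `e : G ≃ₜ* H`, same module, compatible actions) vanish together (the argument of
  `GroupCdLE.of_continuousMulEquiv`, for one module);
* `IsSES.res` — a short exact sequence of discrete `G`-modules restricts to one of `N`-modules.

## References

* J.-P. Serre, *Cohomologie galoisienne* (1997), I §2.4–2.5 (functoriality, compatible pairs).
  [SerreGaloisCohomology1997]
-/

noncomputable section

open CategoryTheory Topology

universe u

namespace Literature.NumberTheory.GaloisRepresentations

open _root_.TopRep _root_.ContRepresentation _root_.ContinuousCohomology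

set_option allowUnsafeReducibility true in
attribute [local reducible] CategoryTheory.Functor.mapHomologicalComplex

/-! ### Composition of restrictions, on elements -/

section Comp

variable {k : Type*} [CommRing k] [TopologicalSpace k]
variable {G : Type u} [Group G] [TopologicalSpace G] [IsTopologicalGroup G]
variable {H : Type u} [Group H] [TopologicalSpace H] [IsTopologicalGroup H]
variable {K : Type u} [Group K] [TopologicalSpace K] [IsTopologicalGroup K]
variable {X : TopRep k G} {Y : TopRep k H} {Z : TopRep k K}

/-- **`resolutionMap` along a composite is the composite**, on elements, for continuous
homomorphisms `χ = φ ∘ ψ` and module maps `h = g ∘ f` given pointwise (compare Mathlib's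
`resolutionMap_comp`, stated for syntactic composites). [folklore] -/
theorem resolutionMap_comp_apply_of (φ : H →ₜ* G) (ψ : K →ₜ* H) (χ : K →ₜ* G)
    (hχ : ∀ x, χ x = φ (ψ x)) (f : res (φ : H →* G) X ⟶ Y) (g : res (ψ : K →* H) Y ⟶ Z)
    (h : res (χ : K →* G) X ⟶ Z) (hh : ∀ v, h.hom v = g.hom (f.hom v)) :
    ∀ (m : ℕ) (w : resolutionX X m),
      (resolutionMap χ h m).hom w = (resolutionMap ψ g m).hom ((resolutionMap φ f m).hom w)
  | 0, w => hh w
  | m + 1, F => by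
    ext x : 1
    change (resolutionMap χ h m).hom ((F : C(G, resolutionX X m)) (χ x)) =
      (resolutionMap ψ g m).hom ((resolutionMap φ f m).hom ((F : C(G, resolutionX X m)) (φ (ψ x))))
    rw [hχ]
    exact resolutionMap_comp_apply_of φ ψ χ hχ f g h hh m _

/-- **`cochainsMap` along a composite is the composite**, on elements. [folklore] -/
theorem cochainsMap_comp_apply_of (φ : H →ₜ* G) (ψ : K →ₜ* H) (χ : K →ₜ* G)
    (hχ : ∀ x, χ x = φ (ψ x)) (f : res (φ : H →* G) X ⟶ Y) (g : res (ψ : K →* H) Y ⟶ Z)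
    (h : res (χ : K →* G) X ⟶ Z) (hh : ∀ v, h.hom v = g.hom (f.hom v)) (i : ℕ)
    (y : (homogeneousCochains X).X i) :
    (cochainsMap χ h).f i y = (cochainsMap ψ g).f i ((cochainsMap φ f).f i y) :=
  Subtype.ext (resolutionMap_comp_apply_of φ ψ χ hχ f g h hh (i + 1) y.1)

/-- **Coboundaries restrict to coboundaries**: if the image of `a` along `φ` is a coboundary,
so is its image along any `χ = φ ∘ ψ`. [folklore] -/
theorem exists_d_eq_cochainsMap_of (φ : H →ₜ* G) (ψ : K →ₜ* H) (χ : K →ₜ* G)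
    (hχ : ∀ x, χ x = φ (ψ x)) (f : res (φ : H →* G) X ⟶ Y) (g : res (ψ : K →* H) Y ⟶ Z)
    (h : res (χ : K →* G) X ⟶ Z) (hh : ∀ v, h.hom v = g.hom (f.hom v)) (n : ℕ)
    (a : (homogeneousCochains X).X (n + 1))
    (ha : ∃ b : (homogeneousCochains Y).X n,
      (homogeneousCochains Y).d n (n + 1) b = (cochainsMap φ f).f (n + 1) a) :
    ∃ c : (homogeneousCochains Z).X n,
      (homogeneousCochains Z).d n (n + 1) c = (cochainsMap χ h).f (n + 1) a := by
  obtain ⟨b, hb⟩ := ha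
  refine ⟨(cochainsMap ψ g).f n b, ?_⟩
  rw [hom_f_d_apply (cochainsMap ψ g) n (n + 1) b, hb,
    cochainsMap_comp_apply_of φ ψ χ hχ f g h hh (n + 1) a]

end Comp

/-! ### Isomorphic pairs -/

section Pair

variable {k : Type*} [CommRing k] [TopologicalSpace k]
variable {G : Type u} [Group G] [TopologicalSpace G] [IsTopologicalGroup G]
variable {H : Type u} [Group H] [TopologicalSpace H] [IsTopologicalGroup H]
variable {M : Type u} [AddCommGroup M] [Module k M] [TopologicalSpace M]
  [IsTopologicalAddGroup M] [ContinuousSMul k M]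

/-- **`Hq` of isomorphic pairs vanish together**: for an isomorphism of topological groups
`e : G ≃ₜ* H` and representations `σ` of `H`, `τ` of `G` on the same topological module with
`τ(g) = σ(e g)`, `Hq(H, σ) = 0 ↔ Hq(G, τ) = 0` (the maps induced by `e` and `e⁻¹` are mutually
inverse: Mathlib `ContinuousCohomology.map_comp`, `map_id`). [folklore] -/
theorem subsingleton_iff_of_continuousMulEquiv (e : G ≃ₜ* H) (σ : ContinuousRep H k M)
    (τ : ContinuousRep G k M) (hστ : ∀ g m, τ g m = σ (e g) m) (q : ℕ) :
    Subsingleton (continuousCohomology q σ.toTopRep) ↔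
      Subsingleton (continuousCohomology q τ.toTopRep) := by
  let f : TopRep.res ((e : G →ₜ* H) : G →* H) σ.toTopRep ⟶ τ.toTopRep :=
    TopRep.ofHom ⟨ContinuousLinearMap.id k M, fun g => by
      ext m
      exact (hστ g m).symm⟩
  let g : TopRep.res ((e.symm : H →ₜ* G) : H →* G) τ.toTopRep ⟶ σ.toTopRep :=
    TopRep.ofHom ⟨ContinuousLinearMap.id k M, fun x => by
      ext m
      change τ (e.symm x) m = σ x m
      rw [hστ, ContinuousMulEquiv.apply_symm_apply]⟩
  have hcomp₁ : ContinuousCohomology.map (e : G →ₜ* H) f q ≫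
      ContinuousCohomology.map (e.symm : H →ₜ* G) g q = 𝟙 _ := by
    rw [← ContinuousCohomology.map_comp]
    refine continuousCohomology_map_eq_id _ _ ?_ (fun x => rfl) q
    ext x
    simp
  have hcomp₂ : ContinuousCohomology.map (e.symm : H →ₜ* G) g q ≫
      ContinuousCohomology.map (e : G →ₜ* H) f q = 𝟙 _ := by
    rw [← ContinuousCohomology.map_comp]
    refine continuousCohomology_map_eq_id _ _ ?_ (fun x => rfl) q
    ext x
    simp
  have key₁ : ∀ x, (ContinuousCohomology.map (e.symm : H →ₜ* G) g q).hom
      ((ContinuousCohomology.map (e : G →ₜ* H) f q).hom x) = x := fun x => by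
    have hx := congr_arg (fun φ => φ.hom x) hcomp₁
    simpa using hx
  have key₂ : ∀ y, (ContinuousCohomology.map (e : G →ₜ* H) f q).hom
      ((ContinuousCohomology.map (e.symm : H →ₜ* G) g q).hom y) = y := fun y => by
    have hy := congr_arg (fun φ => φ.hom y) hcomp₂
    simpa using hy
  constructor
  · intro hσ
    exact ⟨fun a b => by rw [← key₂ a, ← key₂ b, Subsingleton.elim
      ((ContinuousCohomology.map (e.symm : H →ₜ* G) g q).hom a)
      ((ContinuousCohomology.map (e.symm : H →ₜ* G) g q).hom b)]⟩
  · intro hτ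
    exact ⟨fun a b => by rw [← key₁ a, ← key₁ b, Subsingleton.elim
      ((ContinuousCohomology.map (e : G →ₜ* H) f q).hom a)
      ((ContinuousCohomology.map (e : G →ₜ* H) f q).hom b)]⟩

end Pair

/-! ### Restriction of short exact sequences -/

section SES

variable {k : Type*} [CommRing k] [TopologicalSpace k]
variable {G : Type u} [Group G] [TopologicalSpace G] [IsTopologicalGroup G]
variable {M₁ : Type u} [AddCommGroup M₁] [Module k M₁] [TopologicalSpace M₁] [DiscreteTopology M₁]
  [ContinuousSMul k M₁]
variable {M₂ : Type u} [AddCommGroup M₂] [Module k M₂] [TopologicalSpace M₂] [DiscreteTopology M₂]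
  [ContinuousSMul k M₂]
variable {M₃ : Type u} [AddCommGroup M₃] [Module k M₃] [TopologicalSpace M₃] [DiscreteTopology M₃]
  [ContinuousSMul k M₃]
variable {ρ₁ : ContinuousRep G k M₁} {ρ₂ : ContinuousRep G k M₂} {ρ₃ : ContinuousRep G k M₃}

omit [IsTopologicalGroup G] in
/-- A short exact sequence of discrete `G`-modules restricts to a short exact sequence of
`N`-modules (`resModHom`), for every subgroup `N`. [folklore] -/
theorem IsSES.res {f : ρ₁.toTopRep ⟶ ρ₂.toTopRep} {g : ρ₂.toTopRep ⟶ ρ₃.toTopRep}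
    (h : IsSES f g) (N : Subgroup G) : IsSES (resModHom N f) (resModHom N g) :=
  ⟨resModHom_comp_eq_zero N f g h.comp_eq_zero, h.injective, h.exact_mid, h.surjective⟩

end SES

end Literature.NumberTheory.GaloisRepresentations

end
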